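import Summits.AtomisticToContinuum.FouriersLaw.Theorems.BondHeatUncertaintyExtensiveSnapshotIrreversibilityEnergyWindowSkeletonWeights
import Summits.AtomisticToContinuum.FouriersLaw.Theorems.BondHeatUncertaintyExtensiveSnapshotIrreversibilityEnergyWindowGramSampling
import Summits.AtomisticToContinuum.FouriersLaw.Theorems.BondHeatUncertaintyExtensiveSnapshotIrreversibilityEnergyWindowObservationRate
import Summits.AtomisticToContinuum.FouriersLaw.Theorems.BondHeatUncertaintyExtensiveSnapshotIrreversibilityEnergyWindowSkeletonLinearMoment
import HarnessLib

/-!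
# Bond–heat uncertainty window, part U-d1: the harmonic skeleton — deterministic derivatives,
# linear weights, Gaussian moments

Cell `decomp-a2c`, lineage crux `ExtensiveSnapshotIrreversibility` (K_fix half, leaf S3
`KernelTemperatureLipschitz`).  Critic rows 1093 (g) / 1107 (e): before any (SWM)-type claim the
harmonic chain (`lam = β = 0`) must be decided BY HAND in the exact (SWM)-clause shape, with the
rate `s^{-b₀}`, `b₀ = 1/2` — done in part U-d2 (`harmonic_swmBody`); this file is its first half.

* §0 generic algebra over the objects of part R: `2^{-m} Σ_j (a ᵥ* J)_j² = aᵀΓ_m a`,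
  `Γ(Γ+κ)⁻¹c = c − κ(Γ+κ)⁻¹c`, hence `aᵀΓ_m a = a·t − κ|a|²` for `a = (Γ_m+κ)⁻¹ t`; the elementary
  `pivot_bound`; the level threshold `C 2^{-m} ≤ κ`; `ampL² = 2γT_L`; a field that does not depend
  on the skeleton has Skorokhod weight `Σ_j x_j u_j` (the divergence term vanishes).
* §1 the sampling RATE of part U-a2 specialised to the harmonic costate `c_λ(t) = e^{(t−s)𝒢}λ`
  and the momentum output `p_b`: `λ_{p_b}² ≤ (K/s)∫₀ˢβ_λ²` and `β_λ(0)² ≤ (K/s)∫₀ˢβ_λ²`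
  (`harmonic_pivot_rate`; no Kalman condition is used).
* §2 for the harmonic chain the variational equation is linear with constant coefficients, so the
  skeleton Jacobian `J`, the Gram matrix, the controls and the fields of part R do not depend on
  `(z, r, x)` (part U-b `harmonic_variation_eqOn`, `harmonic_fderiv_chainFlow`; the departure
  direction is `e^{s𝒜}(0, e_b)`); hence `w_{m,κ} = Σ_j Ξ_j U_j` is LINEAR in the skeleton and
  `E|w|^q ≤ ((E|Z|^q)^{1/q} √ρ)^q` whenever `2^{-m}Σ_j U_j² ≤ ρ` (part U-f).
References: Nualart (2006) §1.3 (Skorokhod integral of a deterministic field is Wiener–Itô of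
order one); Coron, *Control and Nonlinearity* (2007), §1.2. [folklore]
-/

noncomputable section

namespace Summit.AtomisticToContinuum.FouriersLaw.Theorems.ExtensiveSnapshotIrreversibility.EnergyWindow

open MeasureTheory ProbabilityTheory Filter Topology Set NormedSpace
open scoped ENNReal NNReal Matrix
open Literature.MathematicalPhysics.KineticTheory.HeatConduction
open Literature.Probability.Process Literature.Analysis.ODE

/-! ## 0. Generic algebra -/

section Algebra

variable {ω₂ lam β γ : ℝ} {N : ℕ} {T_L T_R : ℝ} {s : ℝ} {m : ℕ}

/-- The skeleton noise is continuous in time. [folklore] -/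
theorem continuous_skelNoise_of (ω₂ lam β γ : ℝ) (N : ℕ) (T_L T_R : ℝ) (m : ℕ) (r : WienerPair)
    (x : PairSkeleton m) : Continuous (skelNoise ω₂ lam β γ N T_L T_R m r x) :=
  continuous_perturbedNoise (continuous_chainNoise_rem ω₂ lam β γ N T_L T_R r) _ x

/-- `(γ_λ ᵥ* J)_j = ⟨λ, D E^{s}(x)[b_j]⟩`. [folklore] -/
theorem vecMul_skelJacAt_apply (l : PhaseSpace N) (z : PhaseSpace N) (r : WienerPair)
    (x : PairSkeleton m) (j : Fin (2 ^ m) ⊕ Fin (2 ^ m)) :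
    (coordV N l ᵥ* skelJacAt ω₂ lam β γ N T_L T_R s m z r x) j =
      dualPair l (fderiv ℝ (skelFlowMapAt ω₂ lam β γ N T_L T_R s m z r) x (basisX m j)) :=
  coordV_vecMul_jacMat _ l j

/-- **`2^{-m} Σ_j (a ᵥ* J)_j² = aᵀ Γ a`.** [folklore] -/
theorem gramForm_eq_dotProduct (a : Fin N ⊕ Fin N → ℝ) (z : PhaseSpace N) (r : WienerPair)
    (x : PairSkeleton m) :
    ((2 : ℝ) ^ m)⁻¹ * ∑ j, ((a ᵥ* skelJacAt ω₂ lam β γ N T_L T_R s m z r x) j) ^ 2 =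
      a ⬝ᵥ (skelGramAt ω₂ lam β γ N T_L T_R s m z r x *ᵥ a) := by
  rw [skelGramAt, Matrix.smul_mulVec, dotProduct_smul, smul_eq_mul, ← Matrix.mulVec_mulVec,
    Matrix.dotProduct_mulVec, Matrix.mulVec_transpose]
  congr 1
  simp only [dotProduct, sq]

/-- `Γ (Γ+κ)⁻¹ c = c − κ (Γ+κ)⁻¹ c`. [folklore] (dedup gate: identical to the tree's T-b1 `skelGramAt_mulVec_regInv_mulVec` (…SkeletonCoordinates, not imported by this module); kept as a PRIVATE 5-line copy) -/
private theorem skelGramAt_mulVec_ctrl {κ : ℝ} (hκ : 0 < κ) (z : PhaseSpace N) (r : WienerPair)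
    (x : PairSkeleton m) (c : Fin N ⊕ Fin N → ℝ) :
    skelGramAt ω₂ lam β γ N T_L T_R s m z r x *ᵥ
        (regInv (skelGramAt ω₂ lam β γ N T_L T_R s m z r x) κ *ᵥ c) =
      c - κ • (regInv (skelGramAt ω₂ lam β γ N T_L T_R s m z r x) κ *ᵥ c) := by
  have h2 : (skelGramAt ω₂ lam β γ N T_L T_R s m z r x + κ • (1 : Matrix _ _ ℝ)) *ᵥ
      (regInv (skelGramAt ω₂ lam β γ N T_L T_R s m z r x) κ *ᵥ c) = c := by
    rw [Matrix.mulVec_mulVec, self_mul_regInv hκ z r x, Matrix.one_mulVec]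
  rw [Matrix.add_mulVec, Matrix.smul_mulVec, Matrix.one_mulVec] at h2
  exact eq_sub_of_add_eq h2

/-- **`aᵀ Γ a = a·t − κ |a|²` for the regularised control `a = (Γ+κ)⁻¹ t`.** [folklore] -/
theorem gramForm_ctrl_eq {κ : ℝ} (hκ : 0 < κ) (z : PhaseSpace N) (r : WienerPair)
    (x : PairSkeleton m) (t : Fin N ⊕ Fin N → ℝ) :
    ((2 : ℝ) ^ m)⁻¹ * ∑ j, (((regInv (skelGramAt ω₂ lam β γ N T_L T_R s m z r x) κ *ᵥ t) ᵥ*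
        skelJacAt ω₂ lam β γ N T_L T_R s m z r x) j) ^ 2 =
      (regInv (skelGramAt ω₂ lam β γ N T_L T_R s m z r x) κ *ᵥ t) ⬝ᵥ t -
        κ * ((regInv (skelGramAt ω₂ lam β γ N T_L T_R s m z r x) κ *ᵥ t) ⬝ᵥ
          (regInv (skelGramAt ω₂ lam β γ N T_L T_R s m z r x) κ *ᵥ t)) := by
  rw [gramForm_eq_dotProduct, skelGramAt_mulVec_ctrl hκ z r x t, dotProduct_sub, dotProduct_smul,
    smul_eq_mul]

/-- `‖ofCoordV a‖² ≤ |a|²` (sup norm versus Euclidean form). [folklore] -/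
theorem norm_ofCoordV_sq_le_dotProduct (a : Fin N ⊕ Fin N → ℝ) : ‖ofCoordV N a‖ ^ 2 ≤ a ⬝ᵥ a := by
  have hA : 0 ≤ a ⬝ᵥ a := Finset.sum_nonneg fun i _ => mul_self_nonneg (a i)
  have hc : ∀ c, |a c| ≤ Real.sqrt (a ⬝ᵥ a) := fun c =>
    Real.abs_le_sqrt (by
      rw [sq]
      exact Finset.single_le_sum (f := fun i => a i * a i) (fun i _ => mul_self_nonneg (a i))
        (Finset.mem_univ c))
  have hn : ‖ofCoordV N a‖ ≤ Real.sqrt (a ⬝ᵥ a) := by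
    rw [Prod.norm_def]
    refine max_le ?_ ?_ <;>
      refine (pi_norm_le_iff_of_nonneg (Real.sqrt_nonneg _)).2 fun i => ?_
    · rw [Real.norm_eq_abs]; exact hc (Sum.inl i)
    · rw [Real.norm_eq_abs]; exact hc (Sum.inr i)
  calc ‖ofCoordV N a‖ ^ 2 ≤ Real.sqrt (a ⬝ᵥ a) ^ 2 := pow_le_pow_left₀ (norm_nonneg _) hn 2
    _ = a ⬝ᵥ a := Real.sq_sqrt hA

/-- **The elementary pivot bound.**  From `Q = P − κA ≥ 0`, `A ≥ 0`, the sampling lower bound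
`amp²(I/2 − vE) ≤ Q`, the rate `P² ≤ (K/s) I`, `E ≤ cA` and the level condition `amp² v c ≤ κ`:
`Q ≤ 4K/(amp² s)`. [folklore] -/
theorem pivot_bound {P A Q I E amp2 K κ s c v : ℝ} (hκ : 0 < κ) (hs : 0 < s) (hK : 0 < K)
    (hamp : 0 < amp2) (hv : 0 ≤ v) (hQ : Q = P - κ * A) (hQ0 : 0 ≤ Q) (hA0 : 0 ≤ A)
    (hlow : amp2 * (1 / 2 * I - v * E) ≤ Q) (hpiv : P ^ 2 ≤ K / s * I) (hE : E ≤ c * A)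
    (hm : amp2 * (v * c) ≤ κ) : Q ≤ 4 * K / (amp2 * s) := by
  have hP : Q ≤ P := by rw [hQ]; nlinarith [mul_nonneg hκ.le hA0]
  have hP0 : 0 ≤ P := hQ0.trans hP
  have hκA : κ * A ≤ P := by linarith
  have hvE : amp2 * (v * E) ≤ P :=
    calc amp2 * (v * E) ≤ amp2 * (v * (c * A)) :=
          mul_le_mul_of_nonneg_left (mul_le_mul_of_nonneg_left hE hv) hamp.le
      _ = amp2 * (v * c) * A := by ring
      _ ≤ κ * A := mul_le_mul_of_nonneg_right hm hA0
      _ ≤ P := hκA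
  have hI : amp2 * I ≤ 4 * P := by linarith
  have hsP : P ^ 2 * s ≤ K * I := by
    have h := hpiv
    rwa [div_mul_eq_mul_div, le_div_iff₀ hs] at h
  have h4 : amp2 * s * P ^ 2 ≤ 4 * K * P := by
    nlinarith [mul_le_mul_of_nonneg_left hsP hamp.le, mul_le_mul_of_nonneg_left hI hK.le]
  rw [le_div_iff₀ (mul_pos hamp hs)]
  rcases hP0.eq_or_lt with hP0' | hPpos
  · rw [show Q = 0 by linarith, zero_mul]; positivity
  · have h4' : amp2 * s * P * P ≤ 4 * K * P :=
      calc amp2 * s * P * P = amp2 * s * P ^ 2 := by ring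
        _ ≤ 4 * K * P := h4
    calc Q * (amp2 * s) ≤ P * (amp2 * s) := mul_le_mul_of_nonneg_right hP (by positivity)
      _ = amp2 * s * P := by ring
      _ ≤ 4 * K := le_of_mul_le_mul_right h4' hPpos

/-- The level threshold: `C 2^{-m} ≤ κ` for `m ≥ m₁`. [folklore] -/
theorem exists_level_le {κ C : ℝ} (hκ : 0 < κ) (hC : 0 ≤ C) :
    ∃ m₁ : ℕ, ∀ m : ℕ, m₁ ≤ m → C * ((2 : ℝ) ^ m)⁻¹ ≤ κ := by
  obtain ⟨m₁, hm₁⟩ := exists_pow_lt_of_lt_one (div_pos hκ (by positivity : (0 : ℝ) < C + 1))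
    (by norm_num : (2 : ℝ)⁻¹ < 1)
  refine ⟨m₁, fun m hm => ?_⟩
  have h1 : ((2 : ℝ) ^ m)⁻¹ ≤ (2 : ℝ)⁻¹ ^ m₁ := by
    rw [← inv_pow]
    exact pow_le_pow_of_le_one (by norm_num) (by norm_num) hm
  calc C * ((2 : ℝ) ^ m)⁻¹ ≤ (C + 1) * (2 : ℝ)⁻¹ ^ m₁ :=
        mul_le_mul (by linarith) h1 (by positivity) (by positivity)
    _ ≤ (C + 1) * (κ / (C + 1)) := mul_le_mul_of_nonneg_left hm₁.le (by positivity)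
    _ = κ := by field_simp

/-- `ampL² = 2γT_L` (`T_L ≥ 0`, `γ ≥ 0`). [folklore] -/
theorem ampL_sq (ω₂ lam β : ℝ) {γ T_L : ℝ} (hγ : 0 ≤ γ) (hT : 0 ≤ T_L) :
    ampL ω₂ lam β γ T_L ^ 2 = 2 * γ * T_L := by
  unfold ampL
  rw [show (pinnedChain ω₂ lam β γ).γ = γ from rfl, Real.sq_sqrt (by positivity)]

/-- `ampR² = 2γT_R`. [folklore] -/
theorem ampR_sq (ω₂ lam β : ℝ) {γ T_R : ℝ} (hγ : 0 ≤ γ) (hT : 0 ≤ T_R) :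
    ampR ω₂ lam β γ T_R ^ 2 = 2 * γ * T_R := by
  unfold ampR
  rw [show (pinnedChain ω₂ lam β γ).γ = γ from rfl, Real.sq_sqrt (by positivity)]

/-- **A field that does not depend on the skeleton has Skorokhod weight `Σ_j x_j u_j`** (the
divergence term vanishes). [folklore] -/
theorem skelSkorokhod_of_indep (m : ℕ) {u : PairSkeleton m → Fin (2 ^ m) ⊕ Fin (2 ^ m) → ℝ}
    (hu : ∀ y y', u y = u y') (x : PairSkeleton m) :
    skelSkorokhod m u x = ∑ j, coordX m x j * u x j := by
  have h0 : skelDiv u x = 0 := by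
    unfold skelDiv
    refine Finset.sum_eq_zero fun j _ => ?_
    have hc : (fun y => u y j) = fun _ => u x j := funext fun y => by rw [hu y x]
    rw [hc, fderiv_const_apply]
    rfl
  rw [skelSkorokhod, h0, mul_zero, sub_zero]

/-- `√(c s⁻¹) = √c · s^{-1/2}`. [folklore] -/
theorem sqrt_mul_inv_eq {c s : ℝ} (hc : 0 ≤ c) (hs : 0 ≤ s) :
    Real.sqrt (c * s⁻¹) = Real.sqrt c * s ^ (-(1 / 2 : ℝ)) := by
  rw [Real.sqrt_mul hc, Real.sqrt_inv, Real.sqrt_eq_rpow s, ← Real.rpow_neg hs]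

end Algebra

/-! ## 1. The sampling rate for the harmonic costate (part U-a) -/

section Rate

variable (ω₂ γ : ℝ) (N : ℕ)

/-- The momentum-coordinate functional `v ↦ v.2 b`. [folklore] -/
def momCLM (b : Fin N) : PhaseSpace N →L[ℝ] ℝ :=
  (ContinuousLinearMap.proj b).comp (ContinuousLinearMap.snd ℝ (Fin N → ℝ) (Fin N → ℝ))

/-- Unfolding `momCLM`. [folklore] -/
@[simp] theorem momCLM_apply (b : Fin N) (v : PhaseSpace N) : momCLM N b v = v.2 b := rfl

/-- `c_λ(s − u) = e^{−u𝒢} λ`. [folklore] -/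
theorem harmCostate_sub_eq_exp (s : ℝ) (l : PhaseSpace N) (u : ℝ) :
    harmCostate ω₂ γ N s l (s - u) = exp (u • (-harmCoDriftLin ω₂ γ N)) l := by
  unfold harmCostate
  rw [smul_neg, ← neg_smul, show s - u - s = -u by ring]

/-- **The sampling rate of the harmonic costate** (part U-a, no observability needed): for every
site `b` there is `K` with `λ_{p_b}² ≤ (K/s) ∫₀ˢ β_λ²` and `β_λ(0)² ≤ (K/s) ∫₀ˢ β_λ²`,
`β_λ(t) = (c_λ(t))_{p_b}`, all `λ`, `0 < s ≤ 1`. [folklore] -/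
theorem harmonic_pivot_rate (b : Fin N) :
    ∃ K : ℝ, 0 < K ∧ ∀ s : ℝ, 0 < s → s ≤ 1 → ∀ l : PhaseSpace N,
      (l.2 b) ^ 2 ≤ K / s * ∫ t in (0 : ℝ)..s, ((harmCostate ω₂ γ N s l t).2 b) ^ 2 ∧
      ((harmCostate ω₂ γ N s l 0).2 b) ^ 2 ≤
        K / s * ∫ t in (0 : ℝ)..s, ((harmCostate ω₂ γ N s l t).2 b) ^ 2 := by
  obtain ⟨K₁, hK₁, h₁⟩ := sq_output_le_div_mul_integral (-harmCoDriftLin ω₂ γ N) (momCLM N b)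
  obtain ⟨K₂, hK₂, h₂⟩ := sq_output_end_le_div_mul_integral (-harmCoDriftLin ω₂ γ N) (momCLM N b)
  refine ⟨K₁ + K₂, by positivity, fun s hs hs1 l => ?_⟩
  have hint : ∫ t in (0 : ℝ)..s, (momCLM N b (exp (t • (-harmCoDriftLin ω₂ γ N)) l)) ^ 2 =
      ∫ t in (0 : ℝ)..s, ((harmCostate ω₂ γ N s l t).2 b) ^ 2 := by
    have h4 := intervalIntegral.integral_comp_sub_left (a := (0 : ℝ)) (b := s)
      (fun t => ((harmCostate ω₂ γ N s l t).2 b) ^ 2) s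
    simp only [sub_self, sub_zero] at h4
    rw [← h4]
    refine intervalIntegral.integral_congr fun t _ => ?_
    simp only [momCLM_apply]
    rw [← harmCostate_sub_eq_exp ω₂ γ N s l t]
  have hI0 : 0 ≤ ∫ t in (0 : ℝ)..s, ((harmCostate ω₂ γ N s l t).2 b) ^ 2 :=
    intervalIntegral.integral_nonneg hs.le fun t _ => sq_nonneg _
  have h₁' := h₁ s hs hs1 l
  have h₂' := h₂ s hs hs1 l
  rw [hint] at h₁' h₂'
  rw [momCLM_apply] at h₁'
  rw [← harmCostate_sub_eq_exp ω₂ γ N s l s, sub_self, momCLM_apply] at h₂'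
  have hK1 : K₁ / s ≤ (K₁ + K₂) / s := div_le_div_of_nonneg_right (by linarith) hs.le
  have hK2 : K₂ / s ≤ (K₁ + K₂) / s := div_le_div_of_nonneg_right (by linarith) hs.le
  exact ⟨h₁'.trans (mul_le_mul_of_nonneg_right hK1 hI0),
    h₂'.trans (mul_le_mul_of_nonneg_right hK2 hI0)⟩

end Rate

/-! ## 2. The harmonic chain: deterministic skeleton derivatives, linear weights -/

section Harmonic

variable {ω₂ γ : ℝ} (hω : 0 < ω₂) (hγ : 0 < γ) (N : ℕ) (T_L T_R : ℝ)

include hω hγ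

/-- **For the harmonic chain `D_x E^{s}` does not depend on `(z, r, x)`.** [folklore] -/
theorem harmonic_fderiv_skelFlowMapAt_indep {s : ℝ} (hs : s ∈ Icc (0 : ℝ) 1) (m : ℕ)
    (z z' : PhaseSpace N) (r r' : WienerPair) (x x' δ : PairSkeleton m) :
    fderiv ℝ (skelFlowMapAt ω₂ 0 0 γ N T_L T_R s m z r) x δ =
      fderiv ℝ (skelFlowMapAt ω₂ 0 0 γ N T_L T_R s m z' r') x' δ := by
  rw [fderiv_skelFlowMapAt_apply hω le_rfl le_rfl hγ.le N T_L T_R hs m z r x δ,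
    fderiv_skelFlowMapAt_apply hω le_rfl le_rfl hγ.le N T_L T_R hs m z' r' x' δ]
  exact harmonic_variation_eqOn hω hγ.le N z z' _ _ _ x x' δ hs

/-- **Harmonic calibration of (JMˣ)₂: `D²E ≡ 0`.**  The first variation does not depend on the
skeleton point, so the second variation — the integrand of the leaf
`SkeletonSecondVariationMoments` — vanishes identically for the harmonic chain. [folklore] -/
theorem harmonic_fderiv_fderiv_skelFlowMapAt_eq_zero {s : ℝ} (hs : s ∈ Icc (0 : ℝ) 1) (m : ℕ)
    (z : PhaseSpace N) (r : WienerPair) (x δ δ' : PairSkeleton m) :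
    fderiv ℝ (fun y => fderiv ℝ (skelFlowMapAt ω₂ 0 0 γ N T_L T_R s m z r) y δ) x δ' = 0 := by
  have hc : (fun y => fderiv ℝ (skelFlowMapAt ω₂ 0 0 γ N T_L T_R s m z r) y δ) =
      fun _ => fderiv ℝ (skelFlowMapAt ω₂ 0 0 γ N T_L T_R s m z r) x δ :=
    funext fun y => harmonic_fderiv_skelFlowMapAt_indep hω hγ N T_L T_R hs m z z r r y x δ
  rw [hc, fderiv_const_apply]; rfl

/-- The skeleton Jacobian is deterministic. [folklore] -/
theorem harmonic_skelJacAt_indep {s : ℝ} (hs : s ∈ Icc (0 : ℝ) 1) (m : ℕ) (z z' : PhaseSpace N)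
    (r r' : WienerPair) (x x' : PairSkeleton m) :
    skelJacAt ω₂ 0 0 γ N T_L T_R s m z r x = skelJacAt ω₂ 0 0 γ N T_L T_R s m z' r' x' := by
  ext a j
  simp only [skelJacAt, jacMat, ContinuousLinearMap.coe_coe]
  rw [harmonic_fderiv_skelFlowMapAt_indep hω hγ N T_L T_R hs m z z' r r' x x' (basisX m j)]

/-- The arrival field is deterministic. [folklore] -/
theorem harmonic_skelFieldArr_indep {s : ℝ} (hs : s ∈ Icc (0 : ℝ) 1) (m : ℕ) (κ : ℝ) (b : Fin N)
    (z z' : PhaseSpace N) (r r' : WienerPair) (x x' : PairSkeleton m) :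
    skelFieldArr ω₂ 0 0 γ N T_L T_R s m κ b z r x =
      skelFieldArr ω₂ 0 0 γ N T_L T_R s m κ b z' r' x' := by
  unfold skelFieldArr skelCtrlArr skelGramAt
  rw [harmonic_skelJacAt_indep hω hγ N T_L T_R hs m z z' r r' x x']

/-- **The departure direction is `e^{s𝒜}(0, e_b)` in coordinates** (the `z`-derivative of the
affine flow). [folklore] -/
theorem harmonic_skelDepVec_eq {s : ℝ} (hs : s ∈ Icc (0 : ℝ) 1) (m : ℕ) (b : Fin N)
    (z : PhaseSpace N) (r : WienerPair) (x : PairSkeleton m) :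
    skelDepVec ω₂ 0 0 γ N T_L T_R s m b z r x =
      coordV N (exp (s • harmDriftLin ω₂ γ N)
        (((0 : Fin N → ℝ), Pi.single b 1) : PhaseSpace N)) := by
  unfold skelDepVec skelFlowMapAt
  rw [harmonic_fderiv_chainFlow hω hγ.le N (continuous_skelNoise_of ω₂ 0 0 γ N T_L T_R m r x) hs z]

/-- The departure field is deterministic. [folklore] -/
theorem harmonic_skelFieldDep_indep {s : ℝ} (hs : s ∈ Icc (0 : ℝ) 1) (m : ℕ) (κ : ℝ) (b : Fin N)
    (z z' : PhaseSpace N) (r r' : WienerPair) (x x' : PairSkeleton m) :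
    skelFieldDep ω₂ 0 0 γ N T_L T_R s m κ b z r x =
      skelFieldDep ω₂ 0 0 γ N T_L T_R s m κ b z' r' x' := by
  unfold skelFieldDep skelCtrlDep skelGramAt
  rw [harmonic_skelJacAt_indep hω hγ N T_L T_R hs m z z' r r' x x',
    harmonic_skelDepVec_eq hω hγ N T_L T_R hs m b z r x,
    harmonic_skelDepVec_eq hω hγ N T_L T_R hs m b z' r' x']

/-- **The harmonic arrival weight is linear in the skeleton**: `w = Σ_j x_j U_j`, `U` the field
at `(0, 0, 0)`. [folklore] -/
theorem harmonic_skelWeightArr_eq {s : ℝ} (hs : s ∈ Icc (0 : ℝ) 1) (m : ℕ) (κ : ℝ) (b : Fin N)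
    (z : PhaseSpace N) (r : WienerPair) (x : PairSkeleton m) :
    skelWeightArr ω₂ 0 0 γ N T_L T_R s m κ b z r x =
      ∑ j, coordX m x j * skelFieldArr ω₂ 0 0 γ N T_L T_R s m κ b 0 0 0 j := by
  unfold skelWeightArr
  rw [skelSkorokhod_of_indep m (u := skelFieldArr ω₂ 0 0 γ N T_L T_R s m κ b z r)
      (fun y y' => harmonic_skelFieldArr_indep hω hγ N T_L T_R hs m κ b z z r r y y') x,
    harmonic_skelFieldArr_indep hω hγ N T_L T_R hs m κ b z 0 r 0 x 0]

/-- The harmonic departure weight is linear in the skeleton. [folklore] -/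
theorem harmonic_skelWeightDep_eq {s : ℝ} (hs : s ∈ Icc (0 : ℝ) 1) (m : ℕ) (κ : ℝ) (b : Fin N)
    (z : PhaseSpace N) (r : WienerPair) (x : PairSkeleton m) :
    skelWeightDep ω₂ 0 0 γ N T_L T_R s m κ b z r x =
      ∑ j, coordX m x j * skelFieldDep ω₂ 0 0 γ N T_L T_R s m κ b 0 0 0 j := by
  unfold skelWeightDep
  rw [skelSkorokhod_of_indep m (u := skelFieldDep ω₂ 0 0 γ N T_L T_R s m κ b z r)
      (fun y y' => harmonic_skelFieldDep_indep hω hγ N T_L T_R hs m κ b z z r r y y') x,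
    harmonic_skelFieldDep_indep hω hγ N T_L T_R hs m κ b z 0 r 0 x 0]

/-- **Moments of the harmonic arrival weight** are Gaussian moments of a linear functional
(part U-f): `E|w|^q ≤ ((E|Z|^q)^{1/q} √ρ)^q` whenever `2^{-m} Σ_j U_j² ≤ ρ`. [folklore] -/
theorem harmonic_skelMoment_arr_le {s : ℝ} (hs : s ∈ Icc (0 : ℝ) 1) (m : ℕ) {q : ℝ} (hq : 0 < q)
    (κ : ℝ) (b : Fin N) (z : PhaseSpace N) {ρ : ℝ}
    (hρ : ((2 : ℝ) ^ m)⁻¹ * ∑ j, (skelFieldArr ω₂ 0 0 γ N T_L T_R s m κ b 0 0 0 j) ^ 2 ≤ ρ) :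
    skelMoment m q (skelWeightArr ω₂ 0 0 γ N T_L T_R s m κ b z) ≤
      ENNReal.ofReal (((gaussAbsMoment q).toReal ^ q⁻¹ * Real.sqrt ρ) ^ q) := by
  unfold skelMoment
  simp_rw [harmonic_skelWeightArr_eq hω hγ N T_L T_R hs m κ b z]
  exact lintegral_abs_linear_rpow_wienerPair_le m _ hq hρ

/-- Moments of the harmonic departure weight. [folklore] -/
theorem harmonic_skelMoment_dep_le {s : ℝ} (hs : s ∈ Icc (0 : ℝ) 1) (m : ℕ) {q : ℝ} (hq : 0 < q)
    (κ : ℝ) (b : Fin N) (z : PhaseSpace N) {ρ : ℝ}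
    (hρ : ((2 : ℝ) ^ m)⁻¹ * ∑ j, (skelFieldDep ω₂ 0 0 γ N T_L T_R s m κ b 0 0 0 j) ^ 2 ≤ ρ) :
    skelMoment m q (skelWeightDep ω₂ 0 0 γ N T_L T_R s m κ b z) ≤
      ENNReal.ofReal (((gaussAbsMoment q).toReal ^ q⁻¹ * Real.sqrt ρ) ^ q) := by
  unfold skelMoment
  simp_rw [harmonic_skelWeightDep_eq hω hγ N T_L T_R hs m κ b z]
  exact lintegral_abs_linear_rpow_wienerPair_le m _ hq hρ

end Harmonic

end Summit.AtomisticToContinuum.FouriersLaw.Theorems.ExtensiveSnapshotIrreversibility.EnergyWindow
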